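import Mathlib
import HarnessLib
import Summits.NavierStokesRegularity.NavierStokesRegularity.Theorems.HalfSpaceWindowDoorCirculationCarryingRigidityAxisTypeILiouville

/-!
# Route `HalfSpaceWindowDoor`, crux `CirculationCarryingRigidity` (stmt-NavierStokesRegularity-25311) — brick 2 of the one-sided
# eddy-torque engine: CHAINS OF CENTRES inside the closed annular cylinder `{1 ≤ r ≤ 2, |z| ≤ L}`

Line `eddy_torque` (LEAD ns-hsw-p1 g4).  The in-measure replacement of KNSS's plateau (5.14) (bricks 0–1:
`…EddyTorqueOneSided`, `…EddyTorqueMeasurePlateau`) propagates a lower bound for `V = M − F` along a chain of parabolic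
cylinders whose centres move by at most a quarter radius per step.  In KNSS's rescaled box the centres must stay in the closed
annular cylinder `K = {1 ≤ r ≤ 2, |z| ≤ L}` (so that balls of radius `≤ 1/8` about them avoid the tube `{r ≤ 3/4}` where the
drift `((2−A')/r²)x_h` of brick 0 is unbounded).  `exists_chain`: for `σ > 0` and `x₀, y₀ ∈ K` there is `x : ℕ → ℝ³` with
`x 0 = x₀`, `x k = y₀` for `k ≥ n`, `n ≤ (2L + 8π + 2)/σ + 1`, consecutive centres at distance `≤ σ`, all centres in `K` —
the `helical' interpolation `k ↦ cylPt (r₀ + a_k(r₁−r₀)) (θ₀ + a_k(θ₁−θ₀)) (z₀ + a_k(z₁−z₀))`, `a_k = min(k/n, 1)`, which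
interpolates the three cylindrical coordinates simultaneously and therefore never approaches the axis
(`dist_cylPt_le`: `dist ≤ |Δr| + 2|r'||Δθ| + |Δz|`).

Seat ns-hsw-p1 g4 (LEAD of 25311, cell pub-ns-dss).  WHAT THIS IS NOT: not a statement about Navier–Stokes regularity
(Clay A): elementary geometry; no Liouville theorem is proved in this file; helper `--supports` 25311.
-/

noncomputable section

-- the summit and its single sub-problem share the name (CONVENTIONS §1), as in every Theorems file
set_option linter.dupNamespace false

namespace Summit.NavierStokesRegularity.NavierStokesRegularity.Theorems.HalfSpaceWindowDoorCirculationCarryingRigidityEddyTorqueChainGeometry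

open MeasureTheory Set Function Filter Topology TopologicalSpace InnerProductSpace Metric
open scoped RealInnerProductSpace
open Literature.Analysis Literature.Analysis.FluidPDE
open Summit.NavierStokesRegularity.NavierStokesRegularity.Theorems.AxisTwistDoorAveragedConeLiouvilleDefs (cylPt eT)
open Summit.NavierStokesRegularity.NavierStokesRegularity.Theorems.AveragedConeLiouville.ShellBookkeeping (cylRadius_cylPt)
open Summit.NavierStokesRegularity.NavierStokesRegularity.Theorems.HalfSpaceWindowDoorCirculationCarryingRigidityAxisCirculation
  (rotZ_cylPt exists_rotZ_cylPt_eq)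

-- AxisTwistDoor's angular radial unit vector `e_r(θ)` is its `…Defs.eR`; renamed on opening to avoid the clash with the radial
-- unit vector FIELD `Literature.Analysis.FluidPDE.eR`
open Summit.NavierStokesRegularity.NavierStokesRegularity.Theorems.AxisTwistDoorAveragedConeLiouvilleDefs renaming eR → eRang

/-! ### Distances between circle points -/

/-- `cylPt r θ z − cylPt r' θ z = (r − r') e_r(θ)`, so the distance is `|r − r'|`. -/
theorem dist_cylPt_radial (r r' θ z : ℝ) : dist (cylPt r θ z) (cylPt r' θ z) = |r - r'| := by
  rw [dist_eq_norm, EuclideanSpace.norm_eq, Fin.sum_univ_three]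
  simp only [cylPt, PiLp.sub_apply, Matrix.cons_val_zero, Matrix.cons_val_one, Matrix.cons_val,
    Real.norm_eq_abs, sq_abs, sub_self]
  have h : (r * Real.cos θ - r' * Real.cos θ) ^ 2 + (r * Real.sin θ - r' * Real.sin θ) ^ 2 + (0:ℝ) ^ 2 = (r - r') ^ 2 := by
    nlinarith [Real.sin_sq_add_cos_sq θ]
  rw [h, Real.sqrt_sq_eq_abs]

/-- Vertical displacement: `dist (cylPt r θ z) (cylPt r θ z') = |z − z'|`. -/
theorem dist_cylPt_vertical (r θ z z' : ℝ) : dist (cylPt r θ z) (cylPt r θ z') = |z - z'| := by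
  rw [dist_eq_norm, EuclideanSpace.norm_eq, Fin.sum_univ_three]
  simp only [cylPt, PiLp.sub_apply, Matrix.cons_val_zero, Matrix.cons_val_one, Matrix.cons_val,
    Real.norm_eq_abs, sq_abs, sub_self]
  have h : (0:ℝ) ^ 2 + (0:ℝ) ^ 2 + (z - z') ^ 2 = (z - z') ^ 2 := by ring
  rw [h, Real.sqrt_sq_eq_abs]

/-- Angular displacement: `dist (cylPt r θ z) (cylPt r θ' z) ≤ 2|r| |θ − θ'|` (each of `cos`, `sin` is 1-Lipschitz). -/
theorem dist_cylPt_angular (r θ θ' z : ℝ) : dist (cylPt r θ z) (cylPt r θ' z) ≤ 2 * |r| * |θ - θ'| := by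
  rw [dist_eq_norm, EuclideanSpace.norm_eq, Fin.sum_univ_three]
  simp only [cylPt, PiLp.sub_apply, Matrix.cons_val_zero, Matrix.cons_val_one, Matrix.cons_val,
    Real.norm_eq_abs, sq_abs, sub_self]
  have hc : |Real.cos θ - Real.cos θ'| ≤ |θ - θ'| := by
    simpa [dist_eq_norm] using Real.lipschitzWith_cos.dist_le_mul θ θ'
  have hs : |Real.sin θ - Real.sin θ'| ≤ |θ - θ'| := by
    simpa [dist_eq_norm] using Real.lipschitzWith_sin.dist_le_mul θ θ'
  have h1 : (r * Real.cos θ - r * Real.cos θ') ^ 2 ≤ (|r| * |θ - θ'|) ^ 2 := by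
    have : |r * (Real.cos θ - Real.cos θ')| ≤ |r| * |θ - θ'| := by
      rw [abs_mul]; exact mul_le_mul_of_nonneg_left hc (abs_nonneg r)
    calc (r * Real.cos θ - r * Real.cos θ') ^ 2 = |r * (Real.cos θ - Real.cos θ')| ^ 2 := by rw [sq_abs, mul_sub]
      _ ≤ (|r| * |θ - θ'|) ^ 2 := pow_le_pow_left₀ (abs_nonneg _) this 2
  have h2 : (r * Real.sin θ - r * Real.sin θ') ^ 2 ≤ (|r| * |θ - θ'|) ^ 2 := by
    have : |r * (Real.sin θ - Real.sin θ')| ≤ |r| * |θ - θ'| := by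
      rw [abs_mul]; exact mul_le_mul_of_nonneg_left hs (abs_nonneg r)
    calc (r * Real.sin θ - r * Real.sin θ') ^ 2 = |r * (Real.sin θ - Real.sin θ')| ^ 2 := by rw [sq_abs, mul_sub]
      _ ≤ (|r| * |θ - θ'|) ^ 2 := pow_le_pow_left₀ (abs_nonneg _) this 2
  have hnn : 0 ≤ |r| * |θ - θ'| := by positivity
  calc Real.sqrt ((r * Real.cos θ - r * Real.cos θ') ^ 2 + (r * Real.sin θ - r * Real.sin θ') ^ 2 + (0:ℝ) ^ 2)
      ≤ Real.sqrt ((2 * |r| * |θ - θ'|) ^ 2) := by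
        refine Real.sqrt_le_sqrt ?_
        nlinarith
    _ = 2 * |r| * |θ - θ'| := Real.sqrt_sq (by positivity)

/-- Displacement along the `helical' interpolation: moving all three cylindrical coordinates at once,
`dist (cylPt r θ z) (cylPt r' θ' z') ≤ |r − r'| + 2|r'||θ − θ'| + |z − z'|`. -/
theorem dist_cylPt_le (r r' θ θ' z z' : ℝ) :
    dist (cylPt r θ z) (cylPt r' θ' z') ≤ |r - r'| + 2 * |r'| * |θ - θ'| + |z - z'| := by
  have t1 := dist_triangle (cylPt r θ z) (cylPt r' θ z) (cylPt r' θ' z')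
  have t2 := dist_triangle (cylPt r' θ z) (cylPt r' θ' z) (cylPt r' θ' z')
  have e1 := dist_cylPt_radial r r' θ z
  have e3 := dist_cylPt_vertical r' θ' z z'
  have b2 := dist_cylPt_angular r' θ θ' z
  linarith

/-! ### The chain of centres in the closed annular cylinder -/

/-- Every point of the closed annular cylinder `{1 ≤ r ≤ 2, |z| ≤ L}` is `cylPt r θ z` with `1 ≤ r ≤ 2`, `|θ| ≤ π`, `|z| ≤ L`. -/
theorem exists_cylPt_of_mem_annCylClosed {L : ℝ} {x : EuclideanSpace ℝ (Fin 3)} (hx : x ∈ annCylClosed 1 2 L) :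
    ∃ r θ z : ℝ, 1 ≤ r ∧ r ≤ 2 ∧ |θ| ≤ Real.pi ∧ |z| ≤ L ∧ x = cylPt r θ z := by
  obtain ⟨h1, h2, hz⟩ := hx
  refine ⟨cylRadius x, Complex.arg ⟨x 0, x 1⟩, x 2, h1, h2, Complex.abs_arg_le_pi _, hz, ?_⟩
  obtain ⟨θ₀, hθ₀⟩ : ∃ θ₀ : ℝ, θ₀ = Complex.arg ⟨x 0, x 1⟩ ∧ rotZ θ₀ (cylPt (cylRadius x) 0 (x 2)) = x := by
    refine ⟨Complex.arg ⟨x 0, x 1⟩, rfl, ?_⟩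
    have h : cylPt (cylRadius x) 0 (x 2) = meridianPoint (meridian x) := by
      ext i; fin_cases i <;> simp [cylPt, meridianPoint]
    rw [h]; exact rotZ_arg_meridianPoint x
  rw [← hθ₀.1]
  conv_lhs => rw [← hθ₀.2]
  rw [rotZ_cylPt, zero_add]

/-- **A CHAIN OF CENTRES INSIDE THE CLOSED ANNULAR CYLINDER.**  For `L ≥ 0`, a step `σ > 0` and two points `x₀, y₀` of
`K = {1 ≤ r ≤ 2, |z| ≤ L}` there is a sequence of centres `x : ℕ → ℝ³` with `x 0 = x₀`, `x k = y₀` for all `k ≥ n`, where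
`n ≤ (2L + 8π + 2)/σ + 1`, consecutive centres at distance `≤ σ`, and every centre in `K` (the `helical' interpolation of the
three cylindrical coordinates — it never approaches the axis).  With `σ = ρ/4` this is the chain fed to
`…EddyTorqueMeasurePlateau.propagation_from_measure_along_chain` (brick 1); balls of radius `ρ/2 ≤ 1/8` about the centres stay
in the open annular cylinder `{3/4 < r < 5/2, |z| < L + 1/2}` where the rescaled drift of brick 0 is bounded. -/
theorem exists_chain {L σ : ℝ} (hL : 0 ≤ L) (hσ : 0 < σ) {x₀ y₀ : EuclideanSpace ℝ (Fin 3)}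
    (hx₀ : x₀ ∈ annCylClosed 1 2 L) (hy₀ : y₀ ∈ annCylClosed 1 2 L) :
    ∃ (x : ℕ → EuclideanSpace ℝ (Fin 3)) (n : ℕ), x 0 = x₀ ∧ (∀ k : ℕ, n ≤ k → x k = y₀) ∧
      (n : ℝ) ≤ (2 * L + 8 * Real.pi + 2) / σ + 1 ∧
      (∀ k : ℕ, dist (x (k + 1)) (x k) ≤ σ) ∧ (∀ k : ℕ, x k ∈ annCylClosed 1 2 L) := by
  obtain ⟨r₀, θ₀, z₀, hr₀, hr₀', hθ₀, hz₀, rfl⟩ := exists_cylPt_of_mem_annCylClosed hx₀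
  obtain ⟨r₁, θ₁, z₁, hr₁, hr₁', hθ₁, hz₁, rfl⟩ := exists_cylPt_of_mem_annCylClosed hy₀
  -- the total `length budget' and the number of steps
  set D : ℝ := 2 * L + 8 * Real.pi + 2 with hD
  have hDpos : 0 < D := by rw [hD]; positivity
  set n : ℕ := ⌈D / σ⌉₊ with hn
  have hn1 : D / σ ≤ n := Nat.le_ceil _
  have hnpos : 0 < (n : ℝ) := lt_of_lt_of_le (div_pos hDpos hσ) hn1
  have hnpos' : 0 < n := by exact_mod_cast hnpos
  -- the interpolation parameter `a k = min (k/n) 1`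
  set a : ℕ → ℝ := fun k => min ((k : ℝ) / n) 1 with ha
  have ha0 : a 0 = 0 := by simp [ha]
  have ha1 : ∀ k : ℕ, n ≤ k → a k = 1 := by
    intro k hk
    have : (1 : ℝ) ≤ (k : ℝ) / n := by rw [le_div_iff₀ hnpos, one_mul]; exact_mod_cast hk
    simp [ha, min_eq_right this]
  have ha_mem : ∀ k, 0 ≤ a k ∧ a k ≤ 1 := fun k => ⟨le_min (by positivity) zero_le_one, min_le_right _ _⟩
  have ha_step : ∀ k : ℕ, |a (k + 1) - a k| ≤ 1 / n := by
    intro k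
    have h1 : a k ≤ a (k + 1) := min_le_min (div_le_div_of_nonneg_right (by norm_cast; omega) hnpos.le) le_rfl
    have h2 : a (k + 1) ≤ a k + 1 / n := by
      have : ((k + 1 : ℕ) : ℝ) / n = (k : ℝ) / n + 1 / n := by push_cast; ring
      calc a (k + 1) ≤ min ((k : ℝ) / n + 1 / n) (1 + 1 / n) := by
            simp only [ha, this]; exact min_le_min le_rfl (by linarith [one_div_pos.2 hnpos])
        _ = a k + 1 / n := by simp only [ha]; rw [min_add_add_right]
    rw [abs_of_nonneg (by linarith)]; linarith
  refine ⟨fun k => cylPt (r₀ + a k * (r₁ - r₀)) (θ₀ + a k * (θ₁ - θ₀)) (z₀ + a k * (z₁ - z₀)), n, ?_, ?_, ?_, ?_, ?_⟩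
  · simp only [ha0, zero_mul, add_zero]
  · intro k hk; simp only [ha1 k hk, one_mul, add_sub_cancel]
  · calc (n : ℝ) ≤ D / σ + 1 := by
          have := Nat.ceil_lt_add_one (div_nonneg hDpos.le hσ.le); rw [← hn] at this; linarith
      _ = (2 * L + 8 * Real.pi + 2) / σ + 1 := by rw [hD]
  · intro k
    have hr' : |r₀ + a (k + 1) * (r₁ - r₀)| ≤ 2 := by
      obtain ⟨h0, h1⟩ := ha_mem (k + 1)
      rw [abs_le]; constructor <;> nlinarith
    calc dist (cylPt (r₀ + a (k + 1) * (r₁ - r₀)) (θ₀ + a (k + 1) * (θ₁ - θ₀)) (z₀ + a (k + 1) * (z₁ - z₀)))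
          (cylPt (r₀ + a k * (r₁ - r₀)) (θ₀ + a k * (θ₁ - θ₀)) (z₀ + a k * (z₁ - z₀)))
        ≤ |r₀ + a (k + 1) * (r₁ - r₀) - (r₀ + a k * (r₁ - r₀))|
          + 2 * |r₀ + a k * (r₁ - r₀)| * |θ₀ + a (k + 1) * (θ₁ - θ₀) - (θ₀ + a k * (θ₁ - θ₀))|
          + |z₀ + a (k + 1) * (z₁ - z₀) - (z₀ + a k * (z₁ - z₀))| := dist_cylPt_le _ _ _ _ _ _
      _ = |a (k + 1) - a k| * |r₁ - r₀| + 2 * |r₀ + a k * (r₁ - r₀)| * (|a (k + 1) - a k| * |θ₁ - θ₀|)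
          + |a (k + 1) - a k| * |z₁ - z₀| := by
          rw [← abs_mul, ← abs_mul, ← abs_mul]; ring_nf
      _ ≤ (1 / n) * 1 + 2 * 2 * ((1 / n) * (2 * Real.pi)) + (1 / n) * (2 * L) := by
          have hak : |r₀ + a k * (r₁ - r₀)| ≤ 2 := by
            obtain ⟨h0, h1⟩ := ha_mem k
            rw [abs_le]; constructor <;> nlinarith
          have hdr : |r₁ - r₀| ≤ 1 := by rw [abs_le]; constructor <;> linarith
          have hdθ : |θ₁ - θ₀| ≤ 2 * Real.pi := by
            have := abs_sub θ₁ θ₀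
            rw [abs_le] at hθ₀ hθ₁ ⊢; constructor <;> linarith
          have hdz : |z₁ - z₀| ≤ 2 * L := by rw [abs_le] at hz₀ hz₁ ⊢; constructor <;> linarith
          have hs := ha_step k
          have hs0 : 0 ≤ |a (k + 1) - a k| := abs_nonneg _
          gcongr
      _ ≤ D / n := by
          rw [show (1:ℝ) / n * 1 + 2 * 2 * (1 / n * (2 * Real.pi)) + 1 / n * (2 * L) = (2 * L + 8 * Real.pi + 1) / n by
            field_simp; ring]
          rw [hD]
          exact div_le_div_of_nonneg_right (by linarith) hnpos.le
      _ ≤ σ := by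
          rw [div_le_iff₀ hnpos]
          have := mul_le_mul_of_nonneg_left hn1 hσ.le
          rw [mul_div_cancel₀ _ hσ.ne'] at this
          linarith [this]
  · intro k
    obtain ⟨h0, h1⟩ := ha_mem k
    have hr : 1 ≤ r₀ + a k * (r₁ - r₀) ∧ r₀ + a k * (r₁ - r₀) ≤ 2 := by constructor <;> nlinarith
    refine ⟨?_, ?_, ?_⟩
    · rw [cylRadius_cylPt (by linarith [hr.1])]; exact hr.1
    · rw [cylRadius_cylPt (by linarith [hr.1])]; exact hr.2
    · have : (cylPt (r₀ + a k * (r₁ - r₀)) (θ₀ + a k * (θ₁ - θ₀)) (z₀ + a k * (z₁ - z₀))) 2 = z₀ + a k * (z₁ - z₀) := by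
        simp [cylPt]
      rw [this, abs_le]
      rw [abs_le] at hz₀ hz₁
      constructor <;> nlinarith

end Summit.NavierStokesRegularity.NavierStokesRegularity.Theorems.HalfSpaceWindowDoorCirculationCarryingRigidityEddyTorqueChainGeometry

end
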